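import Mathlib.Algebra.Order.BigOperators.Group.Finset
import Mathlib.Algebra.BigOperators.Ring.Finset
import Mathlib.Data.Real.Basic
import Mathlib.Tactic.Linarith
import Mathlib.Tactic.Ring
import HarnessLib

/-!
# The root-set kernel: the ADMISSIBLE / INADMISSIBLE split of RCSET — prim-lf-2 gen 60

Support file (`--supports stmt-CriticalPhenomena-4575`, closed), prover `prim-lf-2` (gen 60).  No definitions, no named facts, no sorries; standard axioms.
Memo `prim-lf-2/CW-ATOM-gen60.md` §3; companions `…RootSetKernelBridge.lean` (RCSET pair ⟹ NO-CORE), `…RootSetKernelTop/RowTwo/RowTwoNonAdj.lean` (rows 1–2).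

THE KERNEL (memo CW-IGCEX-gen58 §8b).  Target `y`, nested root sets `S ⊆ S'`, colourings `s ⊆ E`; `R_S(s)`, `R_{S'}(s)` the red clusters of the sets `S`, `S'`,
`B_{S'}(s) = R_{S'}(E ∖ s)` the blue cluster, `T(X,Y) = (fX − fY)(gX − gY)`.  RCSET(S,S'):  `Φ(S',S') ≤ 2·Φ(S,S')`, i.e.
`Σ_{s : S'-adm} T(R_{S'},B_{S'}) ≤ 2·Σ_{s : S-adm} T(R_S,B_{S'})` with `S'-adm(s) = ¬(y ∈ R_{S'}(s) ∧ y ∈ B_{S'}(s))`, `S-adm(s) = ¬(y ∈ R_S(s) ∧ y ∈ B_{S'}(s))`.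
Since `R_S ⊆ R_{S'}`, every `S'`-admissible colouring is `S`-admissible, and the `S`-admissible colourings split into the `S'`-admissible ones and the
`S'`-INADMISSIBLE ones with `y ∉ R_S`.  Hence the IDENTITY  `2Φ(S,S') − Φ(S',S') = GCBP(S,S') + 2·REST(S,S')` with
  `GCBP(S,S') := Σ_{s : S'-adm} [2·T(R_S,B_{S'}) − T(R_{S'},B_{S'})]`   (RCSET restricted to the `S'`-admissible colourings),
  `REST(S,S') := Σ_{s : y ∈ R_{S'} ∩ B_{S'}, y ∉ R_S} T(R_S,B_{S'})`     (the `S`-kernel on the `S'`-inadmissible colourings),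
and the two CONJECTURES `GCBP ≥ 0`, `REST ≥ 0` (prim-lf-2 gen 60) together imply RCSET(S,S').  Census (gen 60, EXACT over all monotone pairs `(f,g)` via pairs of
up-sets of the poset of occurring sets): every connected simple graph on ≤ 5 vertices, every `y`, every nested pair (182 000 cases): 0 failures of either;
every row-3 atom (8 192 atom hypergraphs): 0 failures of either.  Neither conjecture is termwise: individual cells of `REST` are negative (memo §3).
This file records the split abstractly, for arbitrary maps `RS, RP, BP : Finset ι → Set V` with `RS s ⊆ RP s`:
* `Coefficientwise.kernel_split_identity` — the identity above;
* `Coefficientwise.rcset_of_admPart_of_rest` — `0 ≤ GCBP → 0 ≤ REST → Φ(S',S') ≤ 2·Φ(S,S')`.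
[cite: KozmaNitzan2024, Questions 8–9 (§5.5 p. 36) (context: the Question-8 pocket covariance programme)]
-/

namespace Summit.CriticalPhenomena.PercolationContinuityZ3.Theorems

open Finset

namespace Coefficientwise

variable {ι V : Type*}

open Classical in
/-- **The admissible/inadmissible split of a kernel pair (identity).**  For maps `RS RP BP : Finset ι → Set V` with `RS s ⊆ RP s` (red cluster of `S` inside
the red cluster of `S'`), a target `y`, reals-valued `f, g`, and `T(X,Y) = (fX − fY)(gX − gY)`:
`2·Σ_{¬(y∈RS∧y∈BP)} T(RS,BP) − Σ_{¬(y∈RP∧y∈BP)} T(RP,BP) = Σ_{¬(y∈RP∧y∈BP)} [2T(RS,BP) − T(RP,BP)] + 2·Σ_{(y∈RP∧y∈BP)∧y∉RS} T(RS,BP)`.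
[cite: KozmaNitzan2024, Questions 8–9 (§5.5 p. 36) (context)] -/
theorem kernel_split_identity (D : Finset (Finset ι)) (RS RP BP : Finset ι → Set V) (y : V) (hsub : ∀ s ∈ D, RS s ⊆ RP s) (f g : Set V → ℝ) :
    2 * (∑ s ∈ D.filter (fun s => ¬ (y ∈ RS s ∧ y ∈ BP s)), (f (RS s) - f (BP s)) * (g (RS s) - g (BP s))) -
      ∑ s ∈ D.filter (fun s => ¬ (y ∈ RP s ∧ y ∈ BP s)), (f (RP s) - f (BP s)) * (g (RP s) - g (BP s)) =
    (∑ s ∈ D.filter (fun s => ¬ (y ∈ RP s ∧ y ∈ BP s)),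
        (2 * ((f (RS s) - f (BP s)) * (g (RS s) - g (BP s))) - (f (RP s) - f (BP s)) * (g (RP s) - g (BP s)))) +
      2 * ∑ s ∈ D.filter (fun s => (y ∈ RP s ∧ y ∈ BP s) ∧ y ∉ RS s), (f (RS s) - f (BP s)) * (g (RS s) - g (BP s)) := by
  set TS : Finset ι → ℝ := fun s => (f (RS s) - f (BP s)) * (g (RS s) - g (BP s)) with hTS
  set TU : Finset ι → ℝ := fun s => (f (RP s) - f (BP s)) * (g (RP s) - g (BP s)) with hTU
  change 2 * (∑ s ∈ D.filter (fun s => ¬ (y ∈ RS s ∧ y ∈ BP s)), TS s) - ∑ s ∈ D.filter (fun s => ¬ (y ∈ RP s ∧ y ∈ BP s)), TU s =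
    (∑ s ∈ D.filter (fun s => ¬ (y ∈ RP s ∧ y ∈ BP s)), (2 * TS s - TU s)) +
      2 * ∑ s ∈ D.filter (fun s => (y ∈ RP s ∧ y ∈ BP s) ∧ y ∉ RS s), TS s
  -- split the `S`-admissible colourings by `S'`-admissibility
  have hsplit : ∑ s ∈ D.filter (fun s => ¬ (y ∈ RS s ∧ y ∈ BP s)), TS s =
      ∑ s ∈ D.filter (fun s => ¬ (y ∈ RP s ∧ y ∈ BP s)), TS s + ∑ s ∈ D.filter (fun s => (y ∈ RP s ∧ y ∈ BP s) ∧ y ∉ RS s), TS s := by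
    rw [← Finset.sum_filter_add_sum_filter_not (D.filter (fun s => ¬ (y ∈ RS s ∧ y ∈ BP s))) (fun s => ¬ (y ∈ RP s ∧ y ∈ BP s))]
    congr 1
    · congr 1
      ext s
      simp only [Finset.mem_filter]
      constructor
      · rintro ⟨⟨hs, _⟩, h2⟩; exact ⟨hs, h2⟩
      · rintro ⟨hs, h2⟩; exact ⟨⟨hs, fun ⟨hy1, hy2⟩ => h2 ⟨hsub s hs hy1, hy2⟩⟩, h2⟩
    · congr 1
      ext s
      simp only [Finset.mem_filter, not_not]
      constructor
      · rintro ⟨⟨hs, h1⟩, h2⟩; exact ⟨hs, h2, fun hy => h1 ⟨hy, h2.2⟩⟩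
      · rintro ⟨hs, h2, h3⟩; exact ⟨⟨hs, fun ⟨hy, _⟩ => h3 hy⟩, h2⟩
  have e1 : ∑ s ∈ D.filter (fun s => ¬ (y ∈ RP s ∧ y ∈ BP s)), (2 * TS s - TU s) =
      2 * ∑ s ∈ D.filter (fun s => ¬ (y ∈ RP s ∧ y ∈ BP s)), TS s - ∑ s ∈ D.filter (fun s => ¬ (y ∈ RP s ∧ y ∈ BP s)), TU s := by
    rw [Finset.sum_sub_distrib, Finset.mul_sum]
  rw [hsplit, e1]
  ring

open Classical in
/-- **RCSET from its two halves.**  With the notation of `kernel_split_identity`: if the admissible part `GCBP = Σ_{¬(y∈RP∧y∈BP)} [2T(RS,BP) − T(RP,BP)]` and the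
inadmissible part `REST = Σ_{(y∈RP∧y∈BP)∧y∉RS} T(RS,BP)` are both `≥ 0`, then `Σ_{¬(y∈RP∧y∈BP)} T(RP,BP) ≤ 2·Σ_{¬(y∈RS∧y∈BP)} T(RS,BP)` (RCSET for the pair).
[cite: KozmaNitzan2024, Questions 8–9 (§5.5 p. 36) (context)] -/
theorem rcset_of_admPart_of_rest (D : Finset (Finset ι)) (RS RP BP : Finset ι → Set V) (y : V) (hsub : ∀ s ∈ D, RS s ⊆ RP s) (f g : Set V → ℝ)
    (hadm : 0 ≤ ∑ s ∈ D.filter (fun s => ¬ (y ∈ RP s ∧ y ∈ BP s)),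
        (2 * ((f (RS s) - f (BP s)) * (g (RS s) - g (BP s))) - (f (RP s) - f (BP s)) * (g (RP s) - g (BP s))))
    (hrest : 0 ≤ ∑ s ∈ D.filter (fun s => (y ∈ RP s ∧ y ∈ BP s) ∧ y ∉ RS s), (f (RS s) - f (BP s)) * (g (RS s) - g (BP s))) :
    ∑ s ∈ D.filter (fun s => ¬ (y ∈ RP s ∧ y ∈ BP s)), (f (RP s) - f (BP s)) * (g (RP s) - g (BP s)) ≤
      2 * ∑ s ∈ D.filter (fun s => ¬ (y ∈ RS s ∧ y ∈ BP s)), (f (RS s) - f (BP s)) * (g (RS s) - g (BP s)) := by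
  have h := kernel_split_identity D RS RP BP y hsub f g
  linarith

end Coefficientwise

end Summit.CriticalPhenomena.PercolationContinuityZ3.Theorems
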